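import Summits.BirchSwinnertonDyer.Rank1Residual.Additive.RamifiedSevenGenusKummerColumnOfPsi
import Literature.NumberTheory.EllipticCurves.Kato2004.EllipticUnitKummerCupValuesLinear
import Literature.NumberTheory.EllipticCurves.IsogenyCompProofs
import HarnessLib

set_option autoImplicit false

/-!
# `𝒞₇` genus road (crux `EllipticUnitValueSevenOfGZK`, K7r), touch-(9) item (h) K16-c3-lin — PORT, FILE 1 OF 3 (§0 of the draft of record
# `K16c3Lin_g86.lean` b382336e3ef3e493, bsd-idea-20 g86; critic V#22dn PASS; pen D1117 / D1120 (R12′) / D1121 brief; ported by bsd-cm-k-ty1 g34):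
# the transport of the CM-linearity clause (Z3c) of a value datum along an isogeny pair

The draft of record is ONE 611-line crux workfile; the gate caps `Additive/` files with proofs at 400 lines, so the port is THREE files with the
draft's declarations, statements and proofs UNCHANGED (token for token) and only the module headers rewritten: FILE 1 (this file) = §0
(`KummerColumnLin.isogenyLayerMapK_isogenyLayerMapK_eq_zsmul` — if `ψ ∘ φ = n·χ` pointwise on `E(K̄)` then `ψ_* ∘ φ_* = n·χ_*` on every
`H¹(U, T_p)`; the scalar lemmas `one_tmul_mul_smul`, `one_tmul_intCast_mul` in `ℚ_p ⊗_ℤ K̄`; `KummerColumnLin.lin_transport` — (Z3c) moves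
from `E` to `E′` along `(α, β, d)` for the transported datum `𝔏 ∘ (d⁻¹ · β_*)`); FILE 2 `RamifiedSevenGenusKummerColumnLin.lean` = §2′ (the
Kummer column ∃-packages re-issued from `h159″` carrying (lin)); FILE 3 `PinnedKatoGenusFrameOfRecordLin.lean` = §1 + §3 + §4 (the record
`KummerColumnDataLin`, its constructor `nonempty_kummerColumnDataLin`, the selector `kummerColumnDataLinOf`, ★
`katoGenusFrameOfRecord_expStarCMShape_or`).  See FILE 3's docstring (= the draft's) for the full account of WHAT and WHY.

HONEST LABEL: kernel theorems (this file: unconditional lemmas about push-forwards and scalars, and one transport theorem whose only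
hypothesis is the displayed (Z3c) clause `hlin`); 0 new named facts, no `sorry`, no `instance` declaration, no notation.  Nothing about
Kato's VALUES, a defined `exp*` or the orientation of `√−7` is proved; stmt-BirchSwinnertonDyer-19945 stays OPEN; `X12.CMRamifiedSeven` is
NOT proved; no summit statement is proved; BSD is claimed for no curve.

## References
* K. Kato, Astérisque 295 (2004), §8.1 (8.1.3) (p. 180), (15.6.3) (pp. 253–254), (15.12.1) (p. 263), 15.14 (p. 264). [Kato2004Asterisque]
* S. Bloch, K. Kato (1990), Def. 3.10 and Ex. 3.11 (p. 361). [BlochKato1990]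
* J. H. Silverman, *AEC* (2009), Thm. II.2.3, III.4, Thm. III.6.1 (a), III.7.4. [SilvermanAEC2009]
* J.-P. Serre, *Galois Cohomology* (1997), I §2.2. [SerreGaloisCohomology1997]
-/

noncomputable section

open scoped NumberField TensorProduct
open WeierstrassCurve Field NumberField IsDedekindDomain
open Literature.NumberTheory.IwasawaTheory
open Literature.NumberTheory.GaloisRepresentations Literature.NumberTheory.GaloisRepresentations.LocalWeilDatum
open Literature.NumberTheory.EllipticCurves
open Literature.NumberTheory.EllipticCurves.Rank1Residual
open Literature.NumberTheory.EllipticCurves.IwasawaAlgebra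
open Literature.NumberTheory.EllipticCurves.Kato2004
open Literature.NumberTheory.ComplexMultiplication.EllipticUnits
open Summit.BirchSwinnertonDyer.Rank1Residual
open Summit.BirchSwinnertonDyer.Rank1Residual.Additive.GenusSeven.EllipticUnitColumn
open Summit.BirchSwinnertonDyer.Rank1Residual.Additive.GenusSeven.KummerUnitTower

namespace Summit.BirchSwinnertonDyer.Rank1Residual.Additive.GenusSeven

/-! ## §0 Transport of the CM-linearity clause (Z3c) along an isogeny pair -/

namespace KummerColumnLin

section PushForward

variable {L : Type} [Field L] {V V' V'' : WeierstrassCurve L} (p : ℕ) [Fact p.Prime]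
  [ContinuousSMul ℤ_[p] (V.tateModule p)] [ContinuousSMul ℤ_[p] (V'.tateModule p)] [ContinuousSMul ℤ_[p] (V''.tateModule p)]

/-- **Push-forwards along a pointwise relation `ψ ∘ φ = n · χ`.**  For `K`-isogenies `φ : V → V′`, `ψ : V′ → V″`, `χ : V → V″` with
`ψ (φ P) = n · χ P` on `V(K̄)`, the push-forwards on `H¹(U, T_p·)` satisfy `ψ_* (φ_* c) = n · χ_* c` for every `U ≤ Γ_K` (`[θ] ↦ [T_pψ ∘ T_pφ ∘ θ]`
coordinatewise; the tree's `isogenyLayerMapK_isogenyLayerMapK_of_comp_eq_zsmul` is the case `χ = id`).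
[cite: SilvermanAEC2009, III.7.4] [cite: SerreGaloisCohomology1997, I §2.2] -/
theorem isogenyLayerMapK_isogenyLayerMapK_eq_zsmul (φ : Isogeny V V') (ψ : Isogeny V' V'') (χ : Isogeny V V'')
    {n : ℤ} (h : ∀ P, ψ (φ P) = n • χ P) (U : Subgroup (absoluteGaloisGroup L)) (c : H1 (CM.tateRepK V p) U) :
    isogenyLayerMapK p ψ U (isogenyLayerMapK p φ U c) = n • isogenyLayerMapK p χ U c := by
  obtain ⟨θ, rfl⟩ := oneCocycleClass_surjective _ c
  rw [isogenyLayerMapK_oneCocycleClass, isogenyLayerMapK_oneCocycleClass, isogenyLayerMapK_oneCocycleClass,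
    ← oneCocycleClassₗ_apply (subgroupRep (CM.tateRepK V'' p).toTopRep U),
    ← oneCocycleClassₗ_apply (subgroupRep (CM.tateRepK V'' p).toTopRep U), ← map_zsmul]
  refine congrArg _ (Subtype.ext (ContinuousMap.ext fun g ↦ ?_))
  rw [contOneCocycles.pushAddHom_apply, contOneCocycles.pushAddHom_apply, AddSubgroupClass.coe_zsmul,
    ContinuousMap.zsmul_apply, contOneCocycles.pushAddHom_apply]
  change TateModule.map p ψ.toAddMonoidHom (TateModule.map p φ.toAddMonoidHom (θ.1 g)) =
    n • TateModule.map p χ.toAddMonoidHom (θ.1 g)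
  refine TateModule.ext fun k ↦ ?_
  rw [TateModule.proj_map, TateModule.proj_map, map_zsmul, TateModule.proj_map]
  exact h _

end PushForward

section Scalars

variable {L : Type} [Field L] (p : ℕ) [Fact p.Prime]

/-- `(1 ⊗ x)·(c · t) = c · ((1 ⊗ x)·t)` in `ℚ_p ⊗_ℤ K̄` for `c ∈ ℤ_p` (the `ℤ_p`-action is on the left factor). [folklore] -/
theorem one_tmul_mul_smul (x : AlgebraicClosure L) (c : ℤ_[p]) (t : ℚ_[p] ⊗[ℤ] AlgebraicClosure L) :
    ((1 : ℚ_[p]) ⊗ₜ[ℤ] x) * (c • t) = c • (((1 : ℚ_[p]) ⊗ₜ[ℤ] x) * t) := by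
  induction t using TensorProduct.induction_on with
  | zero => rw [smul_zero, mul_zero, smul_zero]
  | tmul a b =>
      rw [TensorProduct.smul_tmul', Algebra.TensorProduct.tmul_mul_tmul, Algebra.TensorProduct.tmul_mul_tmul,
        TensorProduct.smul_tmul', one_mul, one_mul]
  | add y z hy hz => rw [smul_add, mul_add, hy, hz, mul_add, smul_add]

/-- `(1 ⊗ d)·t = d · t` in `ℚ_p ⊗_ℤ K̄` for an integer `d` (read in `ℤ_p` on the left factor). [folklore] -/
theorem one_tmul_intCast_mul (d : ℤ) (t : ℚ_[p] ⊗[ℤ] AlgebraicClosure L) :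
    ((1 : ℚ_[p]) ⊗ₜ[ℤ] (d : AlgebraicClosure L)) * t = (d : ℤ_[p]) • t := by
  induction t using TensorProduct.induction_on with
  | zero => rw [mul_zero, smul_zero]
  | tmul a b =>
      rw [Algebra.TensorProduct.tmul_mul_tmul, one_mul, ← zsmul_eq_mul, ← TensorProduct.smul_tmul,
        TensorProduct.smul_tmul', Int.cast_smul_eq_zsmul]
  | add y z hy hz => rw [mul_add, hy, hz, smul_add]

end Scalars

section Transport

variable {L : Type} [Field L] [NumberField L] {E E' : WeierstrassCurve L} [E.IsElliptic] [E'.IsElliptic]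
  (p : ℕ) [Fact p.Prime] [ContinuousSMul ℤ_[p] (E.tateModule p)] [ContinuousSMul ℤ_[p] (E'.tateModule p)]

/-- **(Z3c) is transported along an isogeny pair of degree prime to `p·f`.**  Let `α : E → E′`, `β : E′ → E` be `K`-isogenies of elliptic
curves with `β ∘ α = [d]`, `d = u ∈ ℤ_p^×`, `gcd(d, p·f) = 1`, and let `𝔏 = (𝔏_U)_U` be a value datum on `E` which is `O_K`-LINEAR on the normal
layers `U = Gal(K̄/K(E[pⁿf]))` in the sense of (Z3c): every `K`-endomorphism `φ` of `E` with `φ ∘ φ = [m]` acts on `𝔏_U` through a scalar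
`1 ⊗ μ`, `μ ∈ K`, `μ² = m`.  Then the TRANSPORTED datum `𝔏′_U := 𝔏_U ∘ (u⁻¹ · β_*)` on `E′` (the datum of `CM.EllipticZetaBody.isogeny_transport`)
is `O_K`-linear on the normal layers of `E′` (which are those of `E`, `CM.torsionLayer_eq_of_isogeny`): for `φ′ ∈ End_K(E′)` with
`φ′ ∘ φ′ = [m]`, the conjugate `φ₂ := β ∘ φ′ ∘ α ∈ End_K(E)` has `φ₂ ∘ φ₂ = [d·m·d]` (`α ∘ β = [d]`, `α` onto), (Z3c) gives `μ₂` with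
`μ₂² = d m d`, and `φ₂_* β_* = d · β_* φ′_*` yields `𝔏′_U(φ′_* c) = (1 ⊗ μ₂/d)·𝔏′_U(c)`, `(μ₂/d)² = m`.
[cite: Kato2004Asterisque, 15.14 (p. 264), (15.12.1) (p. 263), (15.6.3) (pp. 253–254), §8.1 (8.1.3) (p. 180)]
[cite: BlochKato1990, Def. 3.10 and Ex. 3.11 (p. 361)] [cite: SilvermanAEC2009, Thm. II.2.3, III.4, Thm. III.6.1 (a), III.7.4] -/
theorem lin_transport (α : Isogeny E E') (β : Isogeny E' E) {d : ℤ} (hβα : ∀ P, β (α P) = d • P)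
    (u : ℤ_[p]ˣ) (hu : (u : ℤ_[p]) = d) {f : ℕ} (hdf : IsCoprime d ((p * f : ℕ) : ℤ))
    (𝔏 : ∀ U : Subgroup (absoluteGaloisGroup L), H1 (CM.tateRepK E p) U →ₗ[ℤ_[p]] ℚ_[p] ⊗[ℤ] AlgebraicClosure L)
    (hlin : ∀ (φ : Isogeny E E) (m : ℤ), (∀ P, φ (φ P) = m • P) →
      ∃ μ : L, μ ^ 2 = (m : L) ∧
        ∀ (n : ℕ) (c : H1 (CM.tateRepK E p) (CM.torsionLayer E (p ^ n * f))),
          𝔏 (CM.torsionLayer E (p ^ n * f)) (isogenyLayerMapK p φ (CM.torsionLayer E (p ^ n * f)) c) =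
            ((1 : ℚ_[p]) ⊗ₜ[ℤ] algebraMap L (AlgebraicClosure L) μ) * 𝔏 (CM.torsionLayer E (p ^ n * f)) c) :
    ∀ (φ' : Isogeny E' E') (m : ℤ), (∀ P, φ' (φ' P) = m • P) →
      ∃ μ : L, μ ^ 2 = (m : L) ∧
        ∀ (n : ℕ) (c : H1 (CM.tateRepK E' p) (CM.torsionLayer E' (p ^ n * f))),
          (𝔏 (CM.torsionLayer E' (p ^ n * f)) ∘ₗ
              (((u⁻¹ : ℤ_[p]ˣ) : ℤ_[p]) • isogenyLayerMapK p β (CM.torsionLayer E' (p ^ n * f))))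
            (isogenyLayerMapK p φ' (CM.torsionLayer E' (p ^ n * f)) c) =
          ((1 : ℚ_[p]) ⊗ₜ[ℤ] algebraMap L (AlgebraicClosure L) μ) *
            (𝔏 (CM.torsionLayer E' (p ^ n * f)) ∘ₗ
              (((u⁻¹ : ℤ_[p]ˣ) : ℤ_[p]) • isogenyLayerMapK p β (CM.torsionLayer E' (p ^ n * f)))) c := by
  have hcop : ∀ n : ℕ, IsCoprime d ((p ^ n * f : ℕ) : ℤ) := fun n ↦ by
    have hdf' := hdf
    push_cast at hdf' ⊢
    exact (IsCoprime.pow_right hdf'.of_mul_right_left).mul_right hdf'.of_mul_right_right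
  have htor : ∀ n : ℕ, CM.torsionLayer E' (p ^ n * f) = CM.torsionLayer E (p ^ n * f) := fun n ↦
    CM.torsionLayer_eq_of_isogeny α β hβα (hcop n)
  have hd0 : d ≠ 0 := by
    rintro rfl
    exact u.ne_zero (by rw [hu, Int.cast_zero])
  have hdL : (d : L) ≠ 0 := Int.cast_ne_zero.mpr hd0
  have hdC : (d : AlgebraicClosure L) ≠ 0 := Int.cast_ne_zero.mpr hd0
  have hαβ : ∀ Q : E'.geomPoints, α (β Q) = d • Q := fun Q ↦ by
    obtain ⟨P, rfl⟩ := α.surjective Q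
    rw [hβα, map_zsmul]
  intro φ' m hφ'
  -- the conjugate endomorphism `φ₂ = β ∘ φ′ ∘ α` of `E` squares to `[d·m·d]`
  have hφ₂ : ∀ P, (β.comp (φ'.comp α)) ((β.comp (φ'.comp α)) P) = (d * m * d) • P := fun P ↦ by
    simp only [Isogeny.comp_apply]
    rw [hαβ, map_zsmul, map_zsmul, hφ', map_zsmul, hβα, smul_smul, smul_smul]
  obtain ⟨μ₂, hμ₂, hval⟩ := hlin (β.comp (φ'.comp α)) (d * m * d) hφ₂
  refine ⟨μ₂ * (d : L)⁻¹, ?_, fun n c ↦ ?_⟩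
  · rw [mul_pow, inv_pow, hμ₂, mul_inv_eq_iff_eq_mul₀ (pow_ne_zero 2 hdL)]
    push_cast
    ring
  · -- (Z3c) for `φ₂` on the `E`-layer, generalised to any subgroup EQUAL to it (dependent-type bookkeeping)
    have hval' : ∀ U : Subgroup (absoluteGaloisGroup L), U = CM.torsionLayer E (p ^ n * f) →
        ∀ x : H1 (CM.tateRepK E p) U,
          𝔏 U (isogenyLayerMapK p (β.comp (φ'.comp α)) U x) =
            ((1 : ℚ_[p]) ⊗ₜ[ℤ] algebraMap L (AlgebraicClosure L) μ₂) * 𝔏 U x := by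
      rintro U rfl x
      exact hval n x
    -- `φ₂_* (β_* c) = d · (β ∘ φ′)_* c = d · β_* (φ′_* c)`
    have h1 : isogenyLayerMapK p (β.comp (φ'.comp α)) _ (isogenyLayerMapK p β (CM.torsionLayer E' (p ^ n * f)) c) =
        d • isogenyLayerMapK p (β.comp φ') _ c :=
      isogenyLayerMapK_isogenyLayerMapK_eq_zsmul p β (β.comp (φ'.comp α)) (β.comp φ') (fun Q ↦ by
        simp only [Isogeny.comp_apply]
        rw [hαβ, map_zsmul, map_zsmul]) _ c
    have h2 : isogenyLayerMapK p β _ (isogenyLayerMapK p φ' (CM.torsionLayer E' (p ^ n * f)) c) =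
        (1 : ℤ) • isogenyLayerMapK p (β.comp φ') _ c :=
      isogenyLayerMapK_isogenyLayerMapK_eq_zsmul p φ' β (β.comp φ') (fun Q ↦ by
        rw [one_zsmul, Isogeny.comp_apply]) _ c
    rw [one_zsmul] at h2
    have hμ : algebraMap L (AlgebraicClosure L) μ₂ =
        (d : AlgebraicClosure L) * algebraMap L (AlgebraicClosure L) (μ₂ * (d : L)⁻¹) := by
      rw [map_mul, map_inv₀, map_intCast, mul_left_comm, mul_inv_cancel₀ hdC, mul_one]
    have hsplit : ((1 : ℚ_[p]) ⊗ₜ[ℤ] ((d : AlgebraicClosure L) * algebraMap L (AlgebraicClosure L) (μ₂ * (d : L)⁻¹))) =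
        ((1 : ℚ_[p]) ⊗ₜ[ℤ] (d : AlgebraicClosure L)) *
          ((1 : ℚ_[p]) ⊗ₜ[ℤ] algebraMap L (AlgebraicClosure L) (μ₂ * (d : L)⁻¹)) := by
      rw [Algebra.TensorProduct.tmul_mul_tmul, one_mul]
    have key := hval' _ (htor n) (isogenyLayerMapK p β (CM.torsionLayer E' (p ^ n * f)) c)
    rw [h1, ← h2, ← Int.cast_smul_eq_zsmul ℤ_[p] d, map_smul, hμ, hsplit, mul_assoc, one_tmul_intCast_mul, ← hu]
      at key
    have key' := congrArg (fun t ↦ ((u⁻¹ : ℤ_[p]ˣ) : ℤ_[p]) • t) key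
    simp only [smul_smul, Units.inv_mul, one_smul] at key'
    simp only [LinearMap.coe_comp, Function.comp_apply, LinearMap.smul_apply, map_smul]
    rw [one_tmul_mul_smul, key']

end Transport

end KummerColumnLin

end Summit.BirchSwinnertonDyer.Rank1Residual.Additive.GenusSeven

end
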